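import Mathlib.NumberTheory.Real.Irrational
import Literature.AlgebraicGeometry.Frobenioids.ArithmeticDivisorsPerfFactorial
import Literature.AlgebraicGeometry.Frobenioids.RealificationNatTrans
import Literature.AlgebraicGeometry.Frobenioids.RlfPerfFactorial
import HarnessLib

/-!
# Frobenioids I, Def. 2.4 (i) / Prop. 5.3 — NEGATIVE: `f ↦ f^rlf` does NOT preserve injectivity

Mochizuki, *The geometry of Frobenioids I*, Kyushu J. Math. **62** (2008), Def. 2.4 (i) p. 48 (the realification
`M^rlf`), Prop. 5.3 p. 103 l. 12 ("the divisor monoid `Φ^rlf`" — implicitly: `Φ^rlf` is again a monoid on `D`,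
Def. 1.1 (ii), in particular its pull-backs are characteristically injective) [cite: MochizukiFrdI2008, Prop. 5.3 p.103].

This file records, kernel-checked, the finding P53-F1 (seat abc-iut-L1-d2; ADOPTED by abc-iut-L1-lead R89 (1)):
the universal statement "for perf-factorial `M`, `N` and a characteristically injective `f : M → N`, the induced
`f^rlf : M^rlf → N^rlf` is injective" (the discharge row `RlfMapInjective` of the Prop. 5.3 sub-DAG draft) is
**FALSE**.  WITNESS: `M = ℤ_{≥0}²` (a direct sum of two monoprime monoids, perf-factorial), `N = (ℤ_{≥0})^rlf ≅ ℝ_{≥0}`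
(perf-factorial), `f(a, b) = x^a · y^b` with `x = ι(1)` and `y = x^{√2}`: `f` is injective (`1, √2` are
`ℚ`-independent: `irrational_sqrt_two`) and characteristically injective (both monoids are sharp), but `f^rlf`
identifies `ι(e₀)^{√2}` and `ι(e₁)` — because EVERY homomorphism between realifications commutes with the real
powers (`IsPerfFactorial.Rlf.map_rpow`, seat abc-iut-L1-d2) — while these two elements of `M^rlf` differ (they have
different images under the second projection).  Hence also "`Φ` a monoid on `D` ⇒ `Φ^rlf` a monoid on `D`" fails
for general `Φ` (take `D = {• → •}` with this `f` as the one pull-back); print's "the divisor monoid `Φ^rlf`" uses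
that in the motivating examples pull-backs send distinct primes to elements with disjoint supports.
No definitions.  Seat abc-iut-L1-d2 (cell abc-iut); GAP-LEDGER row P53-F1.
-/

noncomputable section

namespace Literature.AlgebraicGeometry.Frobenioids

open Function Literature.AnabelianGeometry.EtaleTheta

universe u

namespace IsPerfFactorial.Rlf

variable {M : Type u} [CommMonoid M] (h : IsPerfFactorial M)

/-- In `M^rlf` the exponent of a power of a NONZERO element is determined by the power: `a^r = a^s ⇒ r = s`
(`a ≠ 0`). [cite: MochizukiFrdI2008, Def. 2.4(i) p.48] -/
theorem rpow_left_cancel {a : h.Rlf} (ha : a ≠ 1) {r s : NNReal} (hrs : rpow h r a = rpow h s a) : r = s := by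
  haveI := Rlf.isCancelMul h
  have key : ∀ {r s : NNReal}, r ≤ s → rpow h r a = rpow h s a → r = s := by
    intro r s hle hrs
    obtain ⟨d, rfl⟩ := exists_add_of_le hle
    rw [rpow_add] at hrs
    have hd : rpow h d a = 1 := mul_left_cancel (a := rpow h r a) (by rw [mul_one]; exact hrs.symm)
    rcases (rpow_eq_one_iff h d a).mp hd with hd | h1
    · rw [hd, add_zero]
    · exact (ha h1).elim
  rcases le_total r s with hle | hle
  · exact key hle hrs
  · exact (key hle hrs.symm).symm

/-- The natural map `ι : M → M^rlf`, `a ↦ (a ⊗ 1)`, is injective for perf-factorial `M` (`M → M^pf` is injective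
for divisorial `M`; the factorization homomorphism is injective). [cite: MochizukiFrdI2008, Def. 2.4(i) p.48] -/
theorem toRealification_of_injective : Injective (h.toRealification.comp (Perfection.of M)) := by
  intro a b hab
  exact of_injective_of_isSharp_isIntegral_isSaturated h.isDivisorial.isSharp
    h.isDivisorial.isPreDivisorial.isIntegral h.isDivisorial.isPreDivisorial.isSaturated
    (h.factorMap_injective (congrArg Subtype.val hab))

end IsPerfFactorial.Rlf

/-- **P53-F1, kernel-checked: `f ↦ f^rlf` does not preserve (characteristic) injectivity.**  There are
perf-factorial monoids `M`, `N` (in `Type`) and a characteristically injective homomorphism `f : M → N` whose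
realification `f^rlf = IsPerfFactorial.Rlf.map` is not injective — so the draft row
`∀ M N f, IsCharInjective f → Injective f^rlf` is false.  Witness: `M = ℤ_{≥0}²`, `N = (ℤ_{≥0})^rlf`,
`f(a,b) = ι(1)^a · (ι(1)^{√2})^b`. [cite: MochizukiFrdI2008, Prop. 5.3 p.103] -/
theorem not_rlfMap_injective_of_isCharInjective :
    ¬ ∀ ⦃M N : Type⦄ [CommMonoid M] [CommMonoid N] (hM : IsPerfFactorial M) (hN : IsPerfFactorial N)
        (f : M →* N), IsCharInjective f → Injective (IsPerfFactorial.Rlf.map hM hN f) := by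
  intro H
  -- `P = ℤ_{≥0}`, `N = P^rlf`, `M = P ⊕ P`
  have hP : IsPerfFactorial (Multiplicative ℕ) := MonoprimeStructure.isPerfFactorial isMonoprime_multiplicative_nat
  have hN : IsPerfFactorial hP.Rlf := hP.RealificationIsPerfFactorial_holds
  have hM : IsPerfFactorial (directSum (fun _ : Fin 2 => Multiplicative ℕ)) :=
    DirectSum.isPerfFactorial fun _ => isMonoprime_multiplicative_nat
  -- `x = ι(1) ∈ N`, `y = x^{√2}`
  let ιP : Multiplicative ℕ →* hP.Rlf := hP.toRealification.comp (Perfection.of _)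
  let x : hP.Rlf := ιP (Multiplicative.ofAdd 1)
  let y : hP.Rlf := IsPerfFactorial.Rlf.rpow hP (NNReal.sqrt 2) x
  have hx : x ≠ 1 := by
    intro h1
    have : Multiplicative.ofAdd (1 : ℕ) = 1 :=
      IsPerfFactorial.Rlf.toRealification_of_injective hP
        (by rw [(hP.toRealification.comp (Perfection.of _)).map_one]; exact h1)
    exact one_ne_zero (Multiplicative.ofAdd.injective this)
  -- `f(a,b) = x^a y^b = x^{a + b√2}`
  let f : directSum (fun _ : Fin 2 => Multiplicative ℕ) →* hP.Rlf :=
    { toFun := fun g => x ^ Multiplicative.toAdd ((g : ∀ _ : Fin 2, Multiplicative ℕ) 0) *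
        y ^ Multiplicative.toAdd ((g : ∀ _ : Fin 2, Multiplicative ℕ) 1)
      map_one' := by simp only [DirectSum.coe_one, Pi.one_apply, toAdd_one, pow_zero, mul_one]
      map_mul' := fun g g' => by
        simp only [DirectSum.coe_mul, Pi.mul_apply, toAdd_mul, pow_add]
        rw [mul_mul_mul_comm] }
  have hf_apply : ∀ g : directSum (fun _ : Fin 2 => Multiplicative ℕ),
      f g = IsPerfFactorial.Rlf.rpow hP
        (((Multiplicative.toAdd ((g : ∀ _ : Fin 2, Multiplicative ℕ) 0) : ℕ) : NNReal) +
          ((Multiplicative.toAdd ((g : ∀ _ : Fin 2, Multiplicative ℕ) 1) : ℕ) : NNReal) * NNReal.sqrt 2) x := by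
    intro g
    show x ^ _ * y ^ _ = _
    rw [IsPerfFactorial.Rlf.rpow_add, IsPerfFactorial.Rlf.rpow_mul, IsPerfFactorial.Rlf.rpow_natCast,
      IsPerfFactorial.Rlf.rpow_natCast]
  -- `f` is injective: `a + b√2 = a' + b'√2` forces `(a, b) = (a', b')`
  have hf_inj : Injective f := by
    intro g g' hgg'
    rw [hf_apply, hf_apply] at hgg'
    have hexp := IsPerfFactorial.Rlf.rpow_left_cancel hP hx hgg'
    set a := Multiplicative.toAdd ((g : ∀ _ : Fin 2, Multiplicative ℕ) 0) with ha
    set b := Multiplicative.toAdd ((g : ∀ _ : Fin 2, Multiplicative ℕ) 1) with hb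
    set a' := Multiplicative.toAdd ((g' : ∀ _ : Fin 2, Multiplicative ℕ) 0) with ha'
    set b' := Multiplicative.toAdd ((g' : ∀ _ : Fin 2, Multiplicative ℕ) 1) with hb'
    have key : (a : ℝ) + b * Real.sqrt 2 = a' + b' * Real.sqrt 2 := by
      have := congrArg (fun t : NNReal => (t : ℝ)) hexp
      simpa only [NNReal.coe_add, NNReal.coe_mul, NNReal.coe_natCast, Real.coe_sqrt, NNReal.coe_ofNat] using this
    have hbb' : b = b' := by
      by_contra hne
      have hne' : ((b' : ℝ) - b) ≠ 0 := by
        rw [sub_ne_zero]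
        exact_mod_cast (Ne.symm hne)
      apply irrational_sqrt_two.ne_rational ((a : ℤ) - a') ((b' : ℤ) - b)
      push_cast
      field_simp
      linarith
    have haa' : a = a' := by
      rw [hbb'] at key
      exact_mod_cast (add_right_cancel key)
    apply Subtype.ext
    funext i
    fin_cases i
    · exact Multiplicative.toAdd.injective haa'
    · exact Multiplicative.toAdd.injective hbb'
  -- characteristically injective (the target is sharp)
  have hf_char : IsCharInjective f := by
    refine ⟨hf_inj, fun p q hpq => ?_⟩
    obtain ⟨g, rfl⟩ := Associates.mk_surjective p
    obtain ⟨g', rfl⟩ := Associates.mk_surjective q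
    rw [associatesMap_mk, associatesMap_mk, Associates.mk_eq_mk_iff_associated] at hpq
    obtain ⟨w, hw⟩ := hpq
    have hw1 : (w : hP.Rlf) = 1 := (IsPerfFactorial.Rlf.isSharp hP).1 _ w.isUnit
    rw [hw1, mul_one] at hw
    rw [hf_inj hw]
  -- the two elements of `M^rlf` identified by `f^rlf`
  let ιM : directSum (fun _ : Fin 2 => Multiplicative ℕ) →* hM.Rlf := hM.toRealification.comp (Perfection.of _)
  let e₀ : directSum (fun _ : Fin 2 => Multiplicative ℕ) := DirectSum.single 0 (Multiplicative.ofAdd 1)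
  let e₁ : directSum (fun _ : Fin 2 => Multiplicative ℕ) := DirectSum.single 1 (Multiplicative.ofAdd 1)
  have hfe₀ : f e₀ = x := by
    show x ^ Multiplicative.toAdd ((e₀ : ∀ _ : Fin 2, Multiplicative ℕ) 0) *
      y ^ Multiplicative.toAdd ((e₀ : ∀ _ : Fin 2, Multiplicative ℕ) 1) = x
    rw [DirectSum.single_apply_same, DirectSum.single_apply_of_ne (show (1 : Fin 2) ≠ 0 by decide),
      toAdd_ofAdd, toAdd_one, pow_one, pow_zero, mul_one]
  have hfe₁ : f e₁ = y := by
    show x ^ Multiplicative.toAdd ((e₁ : ∀ _ : Fin 2, Multiplicative ℕ) 0) *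
      y ^ Multiplicative.toAdd ((e₁ : ∀ _ : Fin 2, Multiplicative ℕ) 1) = y
    rw [DirectSum.single_apply_same, DirectSum.single_apply_of_ne (show (0 : Fin 2) ≠ 1 by decide),
      toAdd_ofAdd, toAdd_one, pow_one, pow_zero, one_mul]
  let u : hM.Rlf := IsPerfFactorial.Rlf.rpow hM (NNReal.sqrt 2) (ιM e₀)
  let v : hM.Rlf := ιM e₁
  -- `f^rlf u = ι(x)^{√2} = ι(x^{√2}) = f^rlf v`
  have hmap : IsPerfFactorial.Rlf.map hM hN f u = IsPerfFactorial.Rlf.map hM hN f v := by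
    show IsPerfFactorial.Rlf.map hM hN f (IsPerfFactorial.Rlf.rpow hM (NNReal.sqrt 2)
        (hM.toRealification (Perfection.of _ e₀))) =
      IsPerfFactorial.Rlf.map hM hN f (hM.toRealification (Perfection.of _ e₁))
    rw [IsPerfFactorial.Rlf.map_rpow', IsPerfFactorial.Rlf.map_toRealification_of,
      IsPerfFactorial.Rlf.map_toRealification_of, hfe₀, hfe₁]
    exact (IsPerfFactorial.Rlf.map_rpow hP hN (hN.toRealification.comp (Perfection.of _)) (NNReal.sqrt 2) x).symm
  -- but `u ≠ v`: project to the second factor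
  have huv : u ≠ v := by
    intro huv
    let π₁ : directSum (fun _ : Fin 2 => Multiplicative ℕ) →* Multiplicative ℕ :=
      (Pi.evalMonoidHom (fun _ : Fin 2 => Multiplicative ℕ) 1).comp (directSum _).subtype
    have h1 := congrArg (IsPerfFactorial.Rlf.map hM hP π₁) huv
    have hπe₀ : π₁ e₀ = 1 := by
      show (e₀ : ∀ _ : Fin 2, Multiplicative ℕ) 1 = 1
      exact DirectSum.single_apply_of_ne (show (1 : Fin 2) ≠ 0 by decide) _
    have hπe₁ : π₁ e₁ = Multiplicative.ofAdd 1 := by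
      show (e₁ : ∀ _ : Fin 2, Multiplicative ℕ) 1 = Multiplicative.ofAdd 1
      exact DirectSum.single_apply_same _ _
    have lhs : IsPerfFactorial.Rlf.map hM hP π₁ u = 1 := by
      show IsPerfFactorial.Rlf.map hM hP π₁ (IsPerfFactorial.Rlf.rpow hM (NNReal.sqrt 2)
        (hM.toRealification (Perfection.of _ e₀))) = 1
      rw [IsPerfFactorial.Rlf.map_rpow', IsPerfFactorial.Rlf.map_toRealification_of, hπe₀, map_one, map_one,
        map_one]
    have rhs : IsPerfFactorial.Rlf.map hM hP π₁ v = x := by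
      show IsPerfFactorial.Rlf.map hM hP π₁ (hM.toRealification (Perfection.of _ e₁)) = x
      rw [IsPerfFactorial.Rlf.map_toRealification_of, hπe₁]
      rfl
    rw [lhs, rhs] at h1
    exact hx h1.symm
  exact huv (H hM hN f hf_char hmap)

end Literature.AlgebraicGeometry.Frobenioids
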